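import Summits.ValiantsHypothesis.ValiantsHypothesis.Theorems.LacunarySymmetroidMatrixDescartesCensusTropicalKLawSlopes

/-!
# Route `KPlusLogSqLaw`, crux `TropicalB` — the TYPE-PATTERN law: block-structured class patterns are polynomial
# (`n + 1 ≤ (m+1)^(r·c)` for `r + 1` row types and `c + 1` column types, whatever the exponents and valuations)

HONEST FRAMING.  Helper file (seat val-sym-trop-p1 g11, cell `pub-symmetroid`, 2026-08-27) toward the registered stubs `stub_tropThin` /
`stub_tropFat` of `Cruxes/TropicalB/Lines/birth.lean` (crux `Summit.ValiantsHypothesis.ValiantsHypothesis.Theses.KPlusLogSqLaw.TropicalB`,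
ledger item `stmt-ValiantsHypothesis-19771`, route `KPlusLogSqLaw`, DRAFT).  A COUNTING law (an injection of the chain into contingency
tables), valid at every format, in the currency of the STRUCTURE OF THE CLASS PATTERN — complementary to the exponent-structure law
`…TropicalBSumset` (structure of `d`) and to plain slope counting (`TropicalCensus.tropRootLawAt_slopeCount`, no structure).  Nothing here
bounds `TropicalB` inside its window, and nothing is asserted about `WeakLifting`, `KPlusLogSqLaw`, `MatrixDescartes`
(`stmt-ValiantsHypothesis-18050`) or `VP ≠ VNP`.

THE LAW (`chain_succ_le_pow_of_typePattern`).  Let the rows carry TYPES `α : Fin m → Fin (r+1)` and the columns types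
`β : Fin m → Fin (c+1)`, and suppose the class an entry may carry is determined by the two types: `ε a b l ≠ 0 → l = f (α a) (β b)` for
some `f : Fin (r+1) → Fin (c+1) → Fin K` (the support itself is arbitrary inside this pattern; entries may be dead).  Then every
sign-alternating chain of dominant terms `p₀, …, pₙ` at strictly increasing integer slopes has

  `n + 1 ≤ (m + 1) ^ (r * c)`,

for EVERY exponent vector `d` and all valuations `v`.  So block-constant class patterns with `O(1)` blocks are polynomial (e.g. a pattern
constant on the four quadrants of a `2 × 2` block decomposition — any `K` — admits at most `m` breakpoints, like two classes), while slope
counting alone gives `C(m+K−1, m)`.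

PROOF.  The CONTINGENCY TABLE of a present term `p = (σ, λ)` is `N_p(x, y) = #{i : α(σ i) = x, β i = y}`.  (1) The slope is a function of
the table: `slope d p = Σ_i d(f(α(σ i), β i))` (`slope_eq_of_typePattern`), so along the chain — where slopes strictly increase,
`TropicalCensus.slope_lt_of_dominant` — the tables are pairwise distinct (`table_injective_of_chain`).  (2) Every table has the same
margins: row sums `#{a : α a = x}` (`σ` is a bijection, `table_rowSum`) and column sums `#{i : β i = y}` (`table_colSum`); a table with
prescribed margins is determined by its principal `r × c` block (`table_eq_of_block_eq`), whose entries lie in `[0, m]`.  Hence the chain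
injects into `Fin r → Fin c → Fin (m+1)`.

READING (located, not claimed): a cubic `K = 4` family (the cell's D2 fork) or a counterexample to `TropicalB` cannot have a class pattern
that is constant on the blocks of a bounded row/column partition; its class pattern must have large «type rank» in both directions
(compare SHIFT-THREE, whose class depends on `a − b mod m`: `m` types each way).  [folklore: contingency tables with fixed margins]
-/

set_option linter.dupNamespace false
set_option autoImplicit false

namespace Summit.ValiantsHypothesis.ValiantsHypothesis.Theorems.KPlusLogSqLaw.TypePattern

open Summit.ValiantsHypothesis.ValiantsHypothesis.Theorems.MatrixDescartes.Negative
open Summit.ValiantsHypothesis.ValiantsHypothesis.Theorems.LacunarySymmetroidMatrixDescartes.TropicalCensus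
open scoped BigOperators
open Finset

variable {m K r c : ℕ}

/-! ## 1. Contingency tables with fixed margins are determined by their principal block -/

/-- Two `(r+1) × (c+1)` tables of natural numbers with the same row sums, the same column sums and the same principal `r × c` block
are equal. [folklore] -/
theorem table_eq_of_block_eq (N N' : Fin (r + 1) → Fin (c + 1) → ℕ)
    (hrow : ∀ x, ∑ y, N x y = ∑ y, N' x y) (hcol : ∀ y, ∑ x, N x y = ∑ x, N' x y)
    (hblk : ∀ (x : Fin r) (y : Fin c), N x.castSucc y.castSucc = N' x.castSucc y.castSucc) : N = N' := by
  -- the first `r` rows agree everywhere (last column from the row sums)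
  have h1 : ∀ (x : Fin r) (y : Fin (c + 1)), N x.castSucc y = N' x.castSucc y := by
    intro x y
    cases y using Fin.lastCases with
    | cast y => exact hblk x y
    | last =>
      have hx := hrow x.castSucc
      rw [Fin.sum_univ_castSucc, Fin.sum_univ_castSucc] at hx
      have hs : ∑ y : Fin c, N x.castSucc y.castSucc = ∑ y : Fin c, N' x.castSucc y.castSucc :=
        sum_congr rfl fun y _ => hblk x y
      omega
  funext x y
  cases x using Fin.lastCases with
  | cast x => exact h1 x y
  | last =>
    have hy := hcol y
    rw [Fin.sum_univ_castSucc, Fin.sum_univ_castSucc] at hy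
    have hs : ∑ x : Fin r, N x.castSucc y = ∑ x : Fin r, N' x.castSucc y := sum_congr rfl fun x _ => h1 x y
    omega

/-- The principal-block map of tables with entries at most `m` into `Fin r → Fin c → Fin (m+1)` separates tables with common margins.
[folklore] -/
theorem block_injective_of_margins {ι : Type*} (T : ι → Fin (r + 1) → Fin (c + 1) → ℕ) (hle : ∀ k x y, T k x y ≤ m)
    (hrow : ∀ k k' x, ∑ y, T k x y = ∑ y, T k' x y) (hcol : ∀ k k' y, ∑ x, T k x y = ∑ x, T k' x y)
    {k k' : ι}
    (h : (fun (x : Fin r) (y : Fin c) => (⟨T k x.castSucc y.castSucc, Nat.lt_succ_of_le (hle k _ _)⟩ : Fin (m + 1))) =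
      fun (x : Fin r) (y : Fin c) => (⟨T k' x.castSucc y.castSucc, Nat.lt_succ_of_le (hle k' _ _)⟩ : Fin (m + 1))) :
    T k = T k' := by
  refine table_eq_of_block_eq (T k) (T k') (hrow k k') (hcol k k') fun x y => ?_
  have := congrFun (congrFun h x) y
  simpa using congrArg Fin.val this

/-! ## 2. The contingency table of a term under a type pattern -/

/-- Under a type pattern `ε a b l ≠ 0 → l = f (α a) (β b)`, a PRESENT term uses at column `i` the class `f (α (σ i)) (β i)`.
[folklore] -/
theorem class_eq_of_typePattern (ε : Fin m → Fin m → Fin K → ℤ) (α : Fin m → Fin (r + 1)) (β : Fin m → Fin (c + 1))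
    (f : Fin (r + 1) → Fin (c + 1) → Fin K) (hpat : ∀ a b l, ε a b l ≠ 0 → l = f (α a) (β b))
    (p : Equiv.Perm (Fin m) × (Fin m → Fin K)) (hp : termSign ε p ≠ 0) (i : Fin m) :
    p.2 i = f (α (p.1 i)) (β i) := by
  apply hpat
  intro h
  apply hp
  unfold termSign
  exact mul_eq_zero_of_right _ (prod_eq_zero (mem_univ i) h)

/-- Under a type pattern the slope of a present term is read off its contingency table:
`slope d p = Σ_x Σ_y #{i : α (σ i) = x ∧ β i = y} · d (f x y)`. [folklore] -/
theorem slope_eq_of_typePattern (d : Fin K → ℕ) (ε : Fin m → Fin m → Fin K → ℤ) (α : Fin m → Fin (r + 1))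
    (β : Fin m → Fin (c + 1)) (f : Fin (r + 1) → Fin (c + 1) → Fin K) (hpat : ∀ a b l, ε a b l ≠ 0 → l = f (α a) (β b))
    (p : Equiv.Perm (Fin m) × (Fin m → Fin K)) (hp : termSign ε p ≠ 0) :
    Summit.ValiantsHypothesis.ValiantsHypothesis.Theorems.LacunarySymmetroidMatrixDescartes.TropicalCensus.slope d p =
      ∑ x, ∑ y, ((univ.filter fun i => α (p.1 i) = x ∧ β i = y).card : ℤ) * (d (f x y) : ℤ) := by
  unfold Summit.ValiantsHypothesis.ValiantsHypothesis.Theorems.LacunarySymmetroidMatrixDescartes.TropicalCensus.slope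
  -- rewrite each class through the pattern, then group the columns by (row type, column type)
  have e : ∀ i, (d (p.2 i) : ℤ) = (d (f (α (p.1 i)) (β i)) : ℤ) := fun i => by
    rw [class_eq_of_typePattern ε α β f hpat p hp i]
  simp_rw [e]
  rw [← sum_product' (f := fun x y => ((univ.filter fun i => α (p.1 i) = x ∧ β i = y).card : ℤ) * (d (f x y) : ℤ))]
  symm
  calc ∑ xy ∈ univ ×ˢ univ, ((univ.filter fun i => α (p.1 i) = xy.1 ∧ β i = xy.2).card : ℤ) * (d (f xy.1 xy.2) : ℤ)
      = ∑ xy ∈ univ ×ˢ univ, ∑ i ∈ univ.filter (fun i => α (p.1 i) = xy.1 ∧ β i = xy.2), (d (f xy.1 xy.2) : ℤ) := by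
        refine sum_congr rfl fun xy _ => ?_
        rw [sum_const, nsmul_eq_mul]
    _ = ∑ xy ∈ univ ×ˢ univ, ∑ i ∈ univ.filter (fun i => (α (p.1 i), β i) = xy), (d (f (α (p.1 i)) (β i)) : ℤ) := by
        refine sum_congr rfl fun xy _ => ?_
        have hs : univ.filter (fun i => α (p.1 i) = xy.1 ∧ β i = xy.2) = univ.filter (fun i => (α (p.1 i), β i) = xy) := by
          ext i; simp [Prod.ext_iff]
        rw [hs]
        refine sum_congr rfl fun i hi => ?_
        rw [mem_filter] at hi
        rw [← hi.2]
    _ = ∑ i, (d (f (α (p.1 i)) (β i)) : ℤ) := by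
        rw [sum_fiberwise_of_maps_to (g := fun i => (α (p.1 i), β i))]
        intro i _
        exact mem_product.mpr ⟨mem_univ _, mem_univ _⟩

/-- Row sums of the contingency table do not depend on the term: `Σ_y N_p(x, y) = #{a : α a = x}` (the permutation is a bijection).
[folklore] -/
theorem table_rowSum (α : Fin m → Fin (r + 1)) (β : Fin m → Fin (c + 1)) (p : Equiv.Perm (Fin m) × (Fin m → Fin K))
    (x : Fin (r + 1)) :
    ∑ y, (univ.filter fun i => α (p.1 i) = x ∧ β i = y).card = (univ.filter fun a => α a = x).card := by
  rw [← card_biUnion]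
  · -- the union over `y` is the set of columns whose row has type `x`; re-index by the permutation
    have hU : (univ : Finset (Fin (c + 1))).biUnion (fun y => univ.filter fun i => α (p.1 i) = x ∧ β i = y) =
        univ.filter fun i => α (p.1 i) = x := by
      ext i; simp
    rw [hU]
    refine card_bij (fun i _ => p.1 i) (fun i hi => ?_) (fun i _ j _ h => p.1.injective h) (fun a ha => ?_)
    · rw [mem_filter] at hi ⊢; exact ⟨mem_univ _, hi.2⟩
    · refine ⟨p.1.symm a, ?_, by simp⟩
      rw [mem_filter] at ha ⊢; exact ⟨mem_univ _, by simpa using ha.2⟩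
  · intro y _ y' _ hyy
    exact disjoint_filter.mpr fun i _ hi hi' => hyy (hi.2.symm.trans hi'.2)

/-- Column sums of the contingency table do not depend on the term: `Σ_x N_p(x, y) = #{i : β i = y}`. [folklore] -/
theorem table_colSum (α : Fin m → Fin (r + 1)) (β : Fin m → Fin (c + 1)) (p : Equiv.Perm (Fin m) × (Fin m → Fin K))
    (y : Fin (c + 1)) :
    ∑ x, (univ.filter fun i => α (p.1 i) = x ∧ β i = y).card = (univ.filter fun i => β i = y).card := by
  rw [← card_biUnion]
  · congr 1
    ext i; simp
  · intro x _ x' _ hxx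
    exact disjoint_filter.mpr fun i _ hi hi' => hxx (hi.1.symm.trans hi'.1)

/-- an entry of the contingency table is at most `m`. [folklore] -/
theorem table_le (α : Fin m → Fin (r + 1)) (β : Fin m → Fin (c + 1)) (p : Equiv.Perm (Fin m) × (Fin m → Fin K))
    (x : Fin (r + 1)) (y : Fin (c + 1)) :
    (univ.filter fun i => α (p.1 i) = x ∧ β i = y).card ≤ m := by
  calc (univ.filter fun i => α (p.1 i) = x ∧ β i = y).card ≤ (univ : Finset (Fin m)).card := card_le_card (filter_subset _ _)
    _ = m := by rw [card_univ, Fintype.card_fin]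

/-! ## 3. The law -/

/-- Along a sign-alternating dominant chain of a design with a type pattern, the contingency tables of the terms are pairwise distinct
(the slope is a function of the table and slopes strictly increase). [folklore] -/
theorem table_injective_of_chain (d : Fin K → ℕ) (v ε : Fin m → Fin m → Fin K → ℤ) (α : Fin m → Fin (r + 1))
    (β : Fin m → Fin (c + 1)) (f : Fin (r + 1) → Fin (c + 1) → Fin K) (hpat : ∀ a b l, ε a b l ≠ 0 → l = f (α a) (β b))
    {n : ℕ} (θ : Fin (n + 1) → ℤ) (p : Fin (n + 1) → Equiv.Perm (Fin m) × (Fin m → Fin K))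
    (hθ : StrictMono θ) (hdom : ∀ k, IsDominant d v ε (θ k) (p k))
    (halt : ∀ k : Fin n, termSign ε (p k.castSucc) * termSign ε (p k.succ) < 0) :
    Function.Injective fun k => fun x y => (univ.filter fun i => α ((p k).1 i) = x ∧ β i = y).card := by
  -- consecutive terms are distinct (their signs multiply to a negative number)
  have hne : ∀ k : Fin n, p k.castSucc ≠ p k.succ := by
    intro k h
    have := halt k
    rw [h] at this
    exact absurd this (not_lt.mpr (mul_self_nonneg _))
  -- slopes strictly increase
  have hsm : StrictMono fun k =>
      Summit.ValiantsHypothesis.ValiantsHypothesis.Theorems.LacunarySymmetroidMatrixDescartes.TropicalCensus.slope d (p k) := by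
    rw [Fin.strictMono_iff_lt_succ]
    intro k
    exact slope_lt_of_dominant d v ε (hθ Fin.castSucc_lt_succ) (hne k) (hdom _) (hdom _)
  intro k k' h
  apply hsm.injective
  simp only
  rw [slope_eq_of_typePattern d ε α β f hpat (p k) (hdom k).1, slope_eq_of_typePattern d ε α β f hpat (p k') (hdom k').1]
  have h' : ∀ x y, (univ.filter fun i => α ((p k).1 i) = x ∧ β i = y).card =
      (univ.filter fun i => α ((p k').1 i) = x ∧ β i = y).card := fun x y => congrFun (congrFun h x) y
  simp_rw [h']

/-- **TYPE-PATTERN LAW.**  If the rows carry `r + 1` types, the columns `c + 1` types, and the class an entry may carry is determined by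
the two types (`ε a b l ≠ 0 → l = f (α a) (β b)`), then every sign-alternating chain of dominant terms at strictly increasing integer
slopes has `n + 1 ≤ (m + 1) ^ (r * c)` terms — for every exponent vector and all valuations. [folklore: contingency tables with fixed
margins; this packaging is the cell's] -/
theorem chain_succ_le_pow_of_typePattern (d : Fin K → ℕ) (v ε : Fin m → Fin m → Fin K → ℤ) (α : Fin m → Fin (r + 1))
    (β : Fin m → Fin (c + 1)) (f : Fin (r + 1) → Fin (c + 1) → Fin K) (hpat : ∀ a b l, ε a b l ≠ 0 → l = f (α a) (β b))
    {n : ℕ} (θ : Fin (n + 1) → ℤ) (p : Fin (n + 1) → Equiv.Perm (Fin m) × (Fin m → Fin K))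
    (hθ : StrictMono θ) (hdom : ∀ k, IsDominant d v ε (θ k) (p k))
    (halt : ∀ k : Fin n, termSign ε (p k.castSucc) * termSign ε (p k.succ) < 0) :
    n + 1 ≤ (m + 1) ^ (r * c) := by
  -- the tables of the chain, their entries are `≤ m`, their margins are common
  set T : Fin (n + 1) → Fin (r + 1) → Fin (c + 1) → ℕ :=
    fun k x y => (univ.filter fun i => α ((p k).1 i) = x ∧ β i = y).card with hT
  have hle : ∀ k x y, T k x y ≤ m := fun k x y => table_le α β (p k) x y
  have hrow : ∀ k k' x, ∑ y, T k x y = ∑ y, T k' x y := fun k k' x => by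
    simp only [hT]; rw [table_rowSum α β (p k) x, table_rowSum α β (p k') x]
  have hcol : ∀ k k' y, ∑ x, T k x y = ∑ x, T k' x y := fun k k' y => by
    simp only [hT]; rw [table_colSum α β (p k) y, table_colSum α β (p k') y]
  -- the chain injects into tables (slopes), tables inject into principal blocks (margins)
  have hinjT : Function.Injective T := table_injective_of_chain d v ε α β f hpat θ p hθ hdom halt
  have hinj : Function.Injective fun k => fun (x : Fin r) (y : Fin c) =>
      (⟨T k x.castSucc y.castSucc, Nat.lt_succ_of_le (hle k _ _)⟩ : Fin (m + 1)) := by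
    intro k k' h
    exact hinjT (block_injective_of_margins T hle hrow hcol h)
  have hcard := Fintype.card_le_of_injective _ hinj
  simp only [Fintype.card_fin, Fintype.card_pi, prod_const, card_univ] at hcard
  calc n + 1 ≤ ((m + 1) ^ c) ^ r := hcard
    _ = (m + 1) ^ (r * c) := by rw [← pow_mul, mul_comm]

/-- **Quadrant form** (`r = c = 1`): if the class pattern is constant on the four blocks of a row bipartition × a column bipartition
(any `K`, any exponents), a sign-alternating dominant chain has at most `m + 1` terms — as for two classes. [folklore] -/
theorem chain_succ_le_of_quadrants (d : Fin K → ℕ) (v ε : Fin m → Fin m → Fin K → ℤ) (α β : Fin m → Fin 2)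
    (f : Fin 2 → Fin 2 → Fin K) (hpat : ∀ a b l, ε a b l ≠ 0 → l = f (α a) (β b))
    {n : ℕ} (θ : Fin (n + 1) → ℤ) (p : Fin (n + 1) → Equiv.Perm (Fin m) × (Fin m → Fin K))
    (hθ : StrictMono θ) (hdom : ∀ k, IsDominant d v ε (θ k) (p k))
    (halt : ∀ k : Fin n, termSign ε (p k.castSucc) * termSign ε (p k.succ) < 0) :
    n + 1 ≤ m + 1 := by
  simpa using chain_succ_le_pow_of_typePattern (r := 1) (c := 1) d v ε α β f hpat θ p hθ hdom halt

end Summit.ValiantsHypothesis.ValiantsHypothesis.Theorems.KPlusLogSqLaw.TypePattern
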